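import Literature.Computability.Complexity.PolyTimeCountable
import Literature.Computability.Complexity.TM2Window
import Literature.Computability.Complexity.Transducers
import Mathlib.Data.List.ReduceOption
import Mathlib.Data.Set.Finite.List
import Mathlib.Tactic.DeriveFintype
import HarnessLib

/-!
# Configurations of a standard `TM2` machine as block words; one step as a finite-state transduction

Toolkit for universal simulations over Mathlib's multi-stack machines `Turing.FinTM2` (the model
of the tree's classes `P`, `FP`, `PSPACE`, …): the configurations of a *standard machine*
`c : TM2Std.SCode` (`PolyTimeCountable.lean`: stacks `Fin c.nK` over the shared alphabet
`Fin (c.N + 1)`, labels `Fin c.nΛ`, states `Fin c.nσ`; every `FinTM2` is simulated step for step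
by one, `TM2Std.step_tr`) are written as words over a finite **block alphabet** `Blk c`, and one
step of the machine — more generally any map `Φ` of *truncated* configurations — is realised on
these words by a finite-state transducer (`FST`, `Transducers.lean`), hence (sequel
`CfgCodesFP.lean`) by a polynomial-time, indeed linear-time, string function once blocks are
spelled in bits. This is the "one row of the tableau from the previous one" step of every
universal simulation (Arora–Barak 2009, §1.4 and proof of Thm. 1.9; Sipser 2012, proof of
Thm. 9.30), in the `TM2` form dictated by the window lemma `TM2Sim.stepTotal_window`
(`TM2Window.lean`): with `D = depth + 1`, the new label, state and top-`D` windows are a function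
of the old label, state and top-`D` windows, and below depth `D` every stack is copied.

* `encCfg x : List (Blk c)` — the code of a configuration `x`: ONE header block
  `hdr x.l x.var (toWin x.stk)` carrying the label, the state and the top-`D` window of every
  stack, followed, for every stack `k` in the order `ord c` (all stacks, the input stack `c.k₀`
  last), by a separator `sep` and the symbols of the stack below depth `D`;
* `preEnc l v W R` — the same shape with arbitrary windows `W k` (`|W k| ≤ D`) and bodies `R k`
  (not necessarily the normal form of a configuration);
* `passT Φ` — for a map `Φ` of configurations, the transducer that reads the header, applies `Φ`
  to the truncated configuration `⟨l, v, W⟩`, and re-normalises stack by stack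
  (new window = first `D` symbols of `(Φ ⟨l, v, W⟩).stk k ++ R k`, the rest is copied to the
  body; the new header is prepended at the end of the input, `FST.front`);
* `passT_eval_preEnc` — **main lemma**: `(passT Φ).eval (preEnc l v W R) = encCfg ⟨y.l, y.var,
  fun k => y.stk k ++ R k⟩`, `y = Φ ⟨l, v, W⟩`, whenever `Φ` lengthens truncated stacks to at
  most `2D`;
* `stepT := passT (stepTotal c.tm)` — `stepT_eval_encCfg : stepT.eval (encCfg x) = encCfg
  (stepTotal c.tm x)` (one machine step, identity once halted), and `normT := passT id` —
  `normT_eval_preEnc` (normal form of a pre-code, used to code initial configurations).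

The transducer's state is a record of plain lists (`RawSt`) restricted to the invariant `Inv`
(bounded lengths), which makes it a finite type (`St`); all bookkeeping is proved on the raw
transducer `passT₀` and transferred (`passT_eval`).

## References

* S. Arora, B. Barak, *Computational Complexity: A Modern Approach*, CUP 2009, §1.4 (machines as
  strings, universal simulation), proof of Thm. 1.9, Claim 1.6. [AroraBarak2009]
* M. Sipser, *Introduction to the Theory of Computation*, 3rd ed., Cengage 2012, proof of
  Thm. 9.30 (rows of a tableau; locality of a step). [Sipser2012]
* Mathlib, `Mathlib/Computability/TuringMachine/StackTuringMachine.lean` (`TM2.stepAux`,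
  `TM2.Cfg`), `…/Computable.lean` (`FinTM2`).
-/

noncomputable section

namespace Literature.Computability.Complexity

namespace CfgCodes

open Turing TM2Std TM2Sim

variable (c : SCode)

/-! ### Windows -/

/-- The shared stack alphabet of the standard machine `c`. [folklore] -/
abbrev Sym : Type := Fin (c.N + 1)

/-- The window depth: one more than the stack-operation depth of the machine (so that `D ≥ 1`
and the window lemma applies). [folklore] -/
def D : ℕ := depth c.tm + 1

/-- `depth ≤ D`. [folklore] -/
theorem depth_le_D : depth c.tm ≤ D c := Nat.le_succ _

/-- `1 ≤ D`. [folklore] -/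
theorem one_le_D : 1 ≤ D c := Nat.succ_pos _

/-- Windows: for every stack the top `D` cells (`none` below the bottom), as a finite function.
[cite: Sipser2012, Thm. 9.30 (proof)] -/
abbrev Win : Type := Fin c.nK → Fin (D c) → Option (Sym c)

/-- The window of a stack assignment. [folklore] -/
def toWin (S : Fin c.nK → List (Sym c)) : Win c := fun k i => (S k)[(i : ℕ)]?

/-- The stacks (of length `≤ D`) described by a window. [folklore] -/
def ofWin (w : Win c) : Fin c.nK → List (Sym c) := fun k => (List.ofFn (w k)).reduceOption

/-- Reading a list through its first `n` cells gives its first `n` elements. [folklore] -/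
theorem reduceOption_ofFn_getElem? {α : Type} (n : ℕ) :
    ∀ L : List α, (List.ofFn fun i : Fin n => L[(i : ℕ)]?).reduceOption = L.take n := by
  induction n with
  | zero => intro L; simp
  | succ n ih =>
    intro L
    cases L with
    | nil =>
      rw [List.take_nil]
      have : (fun i : Fin (n + 1) => ([] : List α)[(i : ℕ)]?) = fun _ => none := by
        funext i; simp
      rw [this, List.ofFn_const, List.reduceOption_replicate_none]
    | cons a L =>
      rw [List.ofFn_succ]
      have : (fun i : Fin n => (a :: L)[((Fin.succ i : Fin (n + 1)) : ℕ)]?) =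
          fun i : Fin n => L[(i : ℕ)]? := by
        funext i; simp
      simp only [Fin.val_zero, List.getElem?_cons_zero, List.reduceOption_cons_of_some,
        List.take_succ_cons, List.cons.injEq, true_and]
      rw [this]
      exact ih L

/-- `ofWin ∘ toWin` truncates every stack to depth `D`. [folklore] -/
theorem ofWin_toWin (S : Fin c.nK → List (Sym c)) : ofWin c (toWin c S) = fun k => (S k).take (D c) := by
  funext k
  exact reduceOption_ofFn_getElem? (D c) (S k)

/-- The window only depends on the top `D` symbols. [folklore] -/
theorem toWin_take (S : Fin c.nK → List (Sym c)) : toWin c (fun k => (S k).take (D c)) = toWin c S := by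
  funext k i
  simp [toWin, i.2]

/-- Stacks described by a window have length `≤ D`. [folklore] -/
theorem length_ofWin_le (w : Win c) (k : Fin c.nK) : (ofWin c w k).length ≤ D c :=
  (List.reduceOption_length_le _).trans (by simp)

/-! ### The block alphabet and the code of a configuration -/

/-- **Blocks**: a header (label, state, windows), a stack symbol, or a stack separator.
[cite: AroraBarak2009, §1.4] -/
inductive Blk
  | hdr (l : Option (Fin c.nΛ)) (v : Fin c.nσ) (w : Win c)
  | sym (g : Sym c)
  | sep
  deriving DecidableEq, Fintype

/-- The block alphabet is inhabited. [folklore] -/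
instance : Inhabited (Blk c) := ⟨Blk.sep⟩

/-- The order in which the stacks are written: all stacks other than the input stack `c.k₀` in
increasing order, then `c.k₀` (last, so that the code of an initial configuration is a fixed
prefix followed by the input word). [folklore] -/
def ord : List (Fin c.nK) := (List.finRange c.nK).filter (fun k => k ≠ c.k₀) ++ [c.k₀]

/-- Every stack occurs in `ord`. [folklore] -/
theorem mem_ord (k : Fin c.nK) : k ∈ ord c := by
  unfold ord
  by_cases h : k = c.k₀
  · subst h; simp
  · exact List.mem_append_left _ (List.mem_filter.2 ⟨List.mem_finRange k, by simpa using h⟩)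

/-- `ord` has no duplicates. [folklore] -/
theorem nodup_ord : (ord c).Nodup := by
  unfold ord
  refine List.Nodup.append ((List.nodup_finRange _).filter _) (List.nodup_singleton _) ?_
  intro k hk hk'
  simp only [List.mem_singleton] at hk'
  simp [hk'] at hk

/-- `ord` lists each of the `nK` stacks once. [folklore] -/
theorem length_ord : (ord c).length = c.nK := by
  classical
  have hperm : (ord c).Perm (List.finRange c.nK) :=
    (List.perm_ext_iff_of_nodup (nodup_ord c) (List.nodup_finRange _)).2
      fun k => ⟨fun _ => List.mem_finRange k, fun _ => mem_ord c k⟩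
  rw [hperm.length_eq, List.length_finRange]

/-- The body blocks of a family of stack remainders: for each stack in `ord`, a separator followed
by its symbols. [cite: AroraBarak2009, §1.4] -/
def bodyOf (R : Fin c.nK → List (Sym c)) : List (Blk c) :=
  (ord c).flatMap fun k => Blk.sep :: (R k).map Blk.sym

/-- **Pre-codes**: a header with label `l`, state `v`, windows `W` (truncated to `D`), and
arbitrary bodies `R`. [cite: AroraBarak2009, §1.4] -/
def preEnc (l : Option (Fin c.nΛ)) (v : Fin c.nσ) (W R : Fin c.nK → List (Sym c)) : List (Blk c) :=
  Blk.hdr l v (toWin c W) :: bodyOf c R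

/-- **The code of a configuration**: header with the top-`D` windows, bodies = the stacks below
depth `D`. [cite: AroraBarak2009, §1.4] -/
def encCfg (x : c.tm.Cfg) : List (Blk c) :=
  preEnc c x.l x.var x.stk fun k => (x.stk k).drop (D c)

/-- Unfolding `encCfg`. [folklore] -/
theorem encCfg_eq (x : c.tm.Cfg) :
    encCfg c x = Blk.hdr x.l x.var (toWin c x.stk) :: bodyOf c fun k => (x.stk k).drop (D c) := rfl

/-- Length of a body. [folklore] -/
theorem length_bodyOf (R : Fin c.nK → List (Sym c)) :
    (bodyOf c R).length = c.nK + ∑ k, (R k).length := by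
  classical
  unfold bodyOf
  rw [List.length_flatMap]
  have hperm : (ord c).Perm (List.finRange c.nK) :=
    (List.perm_ext_iff_of_nodup (nodup_ord c) (List.nodup_finRange _)).2
      fun k => ⟨fun _ => List.mem_finRange k, fun _ => mem_ord c k⟩
  rw [(hperm.map _).sum_eq]
  simp only [List.length_cons, List.length_map]
  rw [List.sum_map_add]
  simp only [List.map_const', List.sum_replicate, smul_eq_mul, mul_one, List.length_finRange]
  rw [Fin.sum_univ_def, add_comm]

/-- The body of the stack assignment "word `y` on the input stack, all other stacks empty": `nK`
separators followed by the symbols of `y` (the input stack is written last). [folklore] -/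
theorem bodyOf_update_k₀ (y : List (Sym c)) :
    bodyOf c (Function.update (fun _ => []) c.k₀ y) = List.replicate c.nK Blk.sep ++ y.map Blk.sym := by
  have hlen : ((List.finRange c.nK).filter fun k => k ≠ c.k₀).length + 1 = c.nK := by
    have := length_ord c
    rwa [ord, List.length_append, List.length_singleton] at this
  have hconst : ∀ ks : List (Fin c.nK), (∀ k ∈ ks, k ≠ c.k₀) →
      ks.flatMap (fun k => Blk.sep :: (Function.update (fun _ => ([] : List (Sym c))) c.k₀ y k).map Blk.sym) =
        List.replicate ks.length Blk.sep := by
    intro ks hks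
    induction ks with
    | nil => rfl
    | cons k ks ih =>
      rw [List.flatMap_cons, ih fun k' hk' => hks k' (List.mem_cons_of_mem _ hk'),
        Function.update_of_ne (hks k (by simp)), List.map_nil, List.length_cons, List.replicate_succ]
      rfl
  have hks : ∀ k ∈ (List.finRange c.nK).filter (fun k => k ≠ c.k₀), k ≠ c.k₀ := fun k hk => by
    simpa using (List.mem_filter.1 hk).2
  have hrep : List.replicate ((List.finRange c.nK).filter fun k => k ≠ c.k₀).length (Blk.sep : Blk c) ++
      [Blk.sep] = List.replicate c.nK Blk.sep := by
    rw [← List.replicate_succ', hlen]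
  rw [bodyOf, ord, List.flatMap_append, hconst _ hks, List.flatMap_cons, List.flatMap_nil,
    List.append_nil, Function.update_self, ← hrep, List.append_assoc, List.singleton_append]

/-- Length of the code of a configuration: one header, `nK` separators, and the symbols below
depth `D`. [folklore] -/
theorem length_encCfg (x : c.tm.Cfg) :
    (encCfg c x).length = 1 + c.nK + ∑ k, ((x.stk k).drop (D c)).length := by
  rw [encCfg_eq, List.length_cons, length_bodyOf]; ring

/-- The code of a configuration has length at most `1 + nK + Σ |stacks|`. [folklore] -/
theorem length_encCfg_le (x : c.tm.Cfg) :
    (encCfg c x).length ≤ 1 + c.nK + ∑ k, (x.stk k).length := by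
  rw [length_encCfg]
  have : ∑ k, ((x.stk k).drop (D c)).length ≤ ∑ k, (x.stk k).length :=
    Finset.sum_le_sum fun k _ => by simp
  omega

/-! ### The raw transducer -/

/-- Phases of the transducer: before the header, inside the bodies, or dead (malformed input).
[folklore] -/
inductive Phase
  | start
  | body
  | dead
  deriving DecidableEq, Fintype

/-- Raw states: the phase, whether a stack is currently open, the new label and state, the new
top segments of the stacks not yet opened (`pend`, in the order `ord`), the finalised new windows
(`done`), and the window of the open stack collected so far (`acc`). [folklore] -/
@[ext] structure RawSt where
  /-- phase -/
  phase : Phase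
  /-- whether a stack is open -/
  cur : Bool
  /-- new label -/
  lbl : Option (Fin c.nΛ)
  /-- new state -/
  var : Fin c.nσ
  /-- new top segments of the stacks not yet opened -/
  pend : List (List (Sym c))
  /-- finalised new windows -/
  done : List (List (Sym c))
  /-- window of the open stack, collected so far -/
  acc : List (Sym c)

/-- The initial raw state. [folklore] -/
def initSt : RawSt c := ⟨Phase.start, false, none, c.init, [], [], []⟩

/-- The dead raw state. [folklore] -/
def deadSt : RawSt c := ⟨Phase.dead, false, none, c.init, [], [], []⟩

variable {c}

/-- Finalising the open stack (if any): its collected window joins `done`. [folklore] -/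
def RawSt.close (s : RawSt c) : List (List (Sym c)) := if s.cur then s.done ++ [s.acc] else s.done

variable (c)

/-- **One transition of the raw transducer** for the configuration map `Φ`: on the header,
apply `Φ` to the truncated configuration and store the new top segments (cut to `2D` symbols, a
no-op for the maps of interest); on a separator, finalise the open stack and open the next one
(its first `D` new symbols start the window, the others are emitted); on a symbol, extend the
window while it is short, else copy. [cite: AroraBarak2009, §1.4] -/
def rstep (Φ : c.tm.Cfg → c.tm.Cfg) (s : RawSt c) : Blk c → RawSt c × List (Blk c)
  | Blk.hdr l v w =>
    if s.phase = Phase.start then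
      (⟨Phase.body, false, (Φ ⟨l, v, ofWin c w⟩).l, (Φ ⟨l, v, ofWin c w⟩).var,
        (ord c).map (fun k => ((Φ ⟨l, v, ofWin c w⟩).stk k).take (2 * D c)), [], []⟩, [])
    else (deadSt c, [])
  | Blk.sep =>
    if s.phase = Phase.body then
      match s.pend with
      | [] => (deadSt c, [])
      | W :: Ws => (⟨Phase.body, true, s.lbl, s.var, Ws, s.close, W.take (D c)⟩,
          Blk.sep :: (W.drop (D c)).map Blk.sym)
    else (deadSt c, [])
  | Blk.sym g =>
    if s.phase = Phase.body ∧ s.cur = true then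
      if s.acc.length < D c then ({ s with acc := s.acc ++ [g] }, []) else (s, [Blk.sym g])
    else (deadSt c, [])

/-- The final header: if all stacks have been processed, the new label, state and windows.
[folklore] -/
def rfront (s : RawSt c) : List (Blk c) :=
  if s.phase = Phase.body ∧ s.pend = [] ∧ s.close.length = c.nK then
    [Blk.hdr s.lbl s.var (toWin c fun k => s.close.getD ((ord c).idxOf k) [])]
  else []

/-- The raw transducer (states not yet restricted to a finite type). [cite: AroraBarak2009, §1.4] -/
def passT₀ (Φ : c.tm.Cfg → c.tm.Cfg) : FST (RawSt c) (Blk c) (Blk c) where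
  init := initSt c
  step := rstep c Φ
  front := rfront c
  keep := fun _ => true

/-! ### Semantics of the raw transducer on codes -/

section Semantics

variable (Φ : c.tm.Cfg → c.tm.Cfg) (l : Option (Fin c.nΛ)) (v : Fin c.nσ)

/-- Reading the symbols of an open stack: the window fills up to `D` symbols, the rest is
copied. [folklore] -/
theorem run_syms (Ws Ds : List (List (Sym c))) :
    ∀ (R A : List (Sym c)), A.length ≤ D c →
      (passT₀ c Φ).run ⟨Phase.body, true, l, v, Ws, Ds, A⟩ (R.map Blk.sym) =
        (⟨Phase.body, true, l, v, Ws, Ds, (A ++ R).take (D c)⟩,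
          ((A ++ R).drop (D c)).map Blk.sym) := by
  intro R
  induction R with
  | nil =>
    intro A hA
    simp [List.take_of_length_le hA, List.drop_eq_nil_of_le hA]
  | cons g R ih =>
    intro A hA
    rw [List.map_cons, FST.run_cons]
    by_cases hlt : A.length < D c
    · have hstep : (passT₀ c Φ).step ⟨Phase.body, true, l, v, Ws, Ds, A⟩ (Blk.sym g) =
          (⟨Phase.body, true, l, v, Ws, Ds, A ++ [g]⟩, []) := by
        simp [passT₀, rstep, hlt]
      rw [hstep, ih (A ++ [g]) (by simp; omega)]
      simp
    · have hDA : D c ≤ A.length := not_lt.1 hlt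
      have hstep : (passT₀ c Φ).step ⟨Phase.body, true, l, v, Ws, Ds, A⟩ (Blk.sym g) =
          (⟨Phase.body, true, l, v, Ws, Ds, A⟩, [Blk.sym g]) := by
        simp [passT₀, rstep, hlt]
      rw [hstep, ih A hA]
      dsimp only
      rw [List.take_append_of_le_length hDA, List.take_append_of_le_length hDA,
        List.drop_append_of_le_length hDA, List.drop_append_of_le_length hDA,
        List.drop_eq_nil_of_le hA]
      simp

/-- Re-windowing twice is re-windowing once. [folklore] -/
theorem take_take_append (n : ℕ) (W R : List (Sym c)) : (W.take n ++ R).take n = (W ++ R).take n := by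
  rcases le_or_gt n W.length with h | h
  · rw [List.take_append_of_le_length (by simp [h]), List.take_take, min_self,
      List.take_append_of_le_length h]
  · rw [List.take_of_length_le h.le]

/-- The symbols below depth `n` of `W ++ R`, split at the window of `W`. [folklore] -/
theorem drop_append_drop_take_append (n : ℕ) (W R : List (Sym c)) :
    W.drop n ++ (W.take n ++ R).drop n = (W ++ R).drop n := by
  rcases le_or_gt n W.length with h | h
  · rw [List.drop_append_of_le_length (l₁ := W.take n) (by simp [h]),
      List.drop_append_of_le_length h, List.drop_eq_nil_of_le (as := W.take n) (by simp),
      List.nil_append]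
  · rw [List.take_of_length_le h.le, List.drop_eq_nil_of_le h.le, List.nil_append]

/-- The expected final (`done`, `acc`) after processing, from an open stack with collected data
`(Ds, A)`, the remaining stacks `ks` with new top segments `Ws` and bodies `R`. [folklore] -/
def finOf (R : Fin c.nK → List (Sym c)) :
    List (Fin c.nK) → List (List (Sym c)) → List (List (Sym c)) → List (Sym c) →
      List (List (Sym c)) × List (Sym c)
  | k :: ks, W :: Ws, Ds, A => finOf R ks Ws (Ds ++ [A]) ((W ++ R k).take (D c))
  | _, _, Ds, A => (Ds, A)

/-- The expected output while processing the stacks `ks`: for each, a separator and the symbols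
of `W ++ R k` below depth `D`. [folklore] -/
def outOf (R : Fin c.nK → List (Sym c)) : List (Fin c.nK) → List (List (Sym c)) → List (Blk c)
  | k :: ks, W :: Ws => (Blk.sep :: ((W ++ R k).drop (D c)).map Blk.sym) ++ outOf R ks Ws
  | _, _ => []

/-- **Processing the bodies.** From a body state with pending segments `W :: Ws` matching the
remaining stacks `k :: ks` one to one, reading their bodies ends with all stacks processed, the
windows `finOf` collected, and emits `outOf`. [cite: AroraBarak2009, §1.4] -/
theorem run_bodies (R : Fin c.nK → List (Sym c)) :
    ∀ (ks : List (Fin c.nK)) (Ws : List (List (Sym c))) (k : Fin c.nK) (W : List (Sym c))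
      (cur : Bool) (Ds : List (List (Sym c))) (A : List (Sym c)), Ws.length = ks.length →
      (passT₀ c Φ).run ⟨Phase.body, cur, l, v, W :: Ws, Ds, A⟩
          ((k :: ks).flatMap fun j => Blk.sep :: (R j).map Blk.sym) =
        (⟨Phase.body, true, l, v, [],
            (finOf c R ks Ws (RawSt.close ⟨Phase.body, cur, l, v, W :: Ws, Ds, A⟩)
              ((W ++ R k).take (D c))).1,
            (finOf c R ks Ws (RawSt.close ⟨Phase.body, cur, l, v, W :: Ws, Ds, A⟩)
              ((W ++ R k).take (D c))).2⟩,
          outOf c R (k :: ks) (W :: Ws)) := by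
  intro ks
  induction ks with
  | nil =>
    intro Ws k W cur Ds A hlen
    cases Ws with
    | cons W' Ws => simp at hlen
    | nil =>
      rw [List.flatMap_cons, List.flatMap_nil, List.append_nil, FST.run_cons]
      have hstep : (passT₀ c Φ).step ⟨Phase.body, cur, l, v, [W], Ds, A⟩ Blk.sep =
          (⟨Phase.body, true, l, v, [], RawSt.close ⟨Phase.body, cur, l, v, [W], Ds, A⟩,
            W.take (D c)⟩, Blk.sep :: (W.drop (D c)).map Blk.sym) := by
        simp [passT₀, rstep]
      rw [hstep]
      dsimp only
      rw [run_syms c Φ l v [] _ (R k) (W.take (D c)) (List.length_take_le _ _), take_take_append]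
      simp only [finOf, outOf, List.append_nil, List.cons_append, List.cons.injEq, true_and,
        Prod.mk.injEq]
      rw [← drop_append_drop_take_append c (D c) W (R k), List.map_append]
  | cons k' ks ih =>
    intro Ws k W cur Ds A hlen
    cases Ws with
    | nil => simp at hlen
    | cons W' Ws =>
      simp only [List.length_cons, Nat.succ.injEq] at hlen
      rw [List.flatMap_cons, List.cons_append, FST.run_cons]
      have hstep : (passT₀ c Φ).step ⟨Phase.body, cur, l, v, W :: W' :: Ws, Ds, A⟩ Blk.sep =
          (⟨Phase.body, true, l, v, W' :: Ws, RawSt.close ⟨Phase.body, cur, l, v, W :: W' :: Ws, Ds, A⟩,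
            W.take (D c)⟩, Blk.sep :: (W.drop (D c)).map Blk.sym) := by
        simp [passT₀, rstep]
      rw [hstep]
      dsimp only
      rw [FST.run_append, run_syms c Φ l v (W' :: Ws) _ (R k) (W.take (D c)) (List.length_take_le _ _),
        take_take_append, ih Ws k' W' true _ _ hlen]
      simp only [finOf, outOf, RawSt.close, if_true, List.cons_append,
        Prod.mk.injEq, List.cons.injEq, true_and]
      rw [← drop_append_drop_take_append c (D c) W (R k), List.map_append, List.append_assoc]

/-- The collected windows, flattened: the old ones, then one window per processed stack.
[folklore] -/
theorem finOf_eq (R S : Fin c.nK → List (Sym c)) :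
    ∀ (ks : List (Fin c.nK)) (Ds : List (List (Sym c))) (A : List (Sym c)),
      (finOf c R ks (ks.map S) Ds A).1 ++ [(finOf c R ks (ks.map S) Ds A).2] =
        Ds ++ [A] ++ ks.map fun j => (S j ++ R j).take (D c) := by
  intro ks
  induction ks with
  | nil => intro Ds A; simp [finOf]
  | cons k ks ih =>
    intro Ds A
    simp [List.map_cons, finOf, ih]

/-- The emitted body is the body of the new stacks. [folklore] -/
theorem outOf_eq (R S : Fin c.nK → List (Sym c)) :
    ∀ ks : List (Fin c.nK),
      outOf c R ks (ks.map S) = ks.flatMap fun j => Blk.sep :: ((S j ++ R j).drop (D c)).map Blk.sym := by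
  intro ks
  induction ks with
  | nil => simp [outOf]
  | cons k ks ih => simp [outOf, ih]

/-- Reading back the window list by position in `ord`. [folklore] -/
theorem getD_map_ord (g : Fin c.nK → List (Sym c)) (k : Fin c.nK) :
    ((ord c).map g).getD ((ord c).idxOf k) [] = g k := by
  rw [List.getD_eq_getElem?_getD, List.getElem?_map, List.getElem?_idxOf (mem_ord c k)]
  rfl

/-- `ord` as head and tail. [folklore] -/
theorem ord_eq_cons : ∃ k ks, ord c = k :: ks := by
  cases h : ord c with
  | nil =>
    have h1 := length_ord c
    rw [h, List.length_nil] at h1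
    exact absurd h1 (Nat.ne_of_lt (Fin.pos c.k₀))
  | cons k ks => exact ⟨k, ks, rfl⟩

/-- **The raw transducer on a pre-code.** If `Φ` maps configurations with stacks of length `≤ D`
to configurations with stacks of length `≤ 2D`, then on the pre-code with windows `W`
(`|W k| ≤ D`) and bodies `R` the transducer outputs the code of `⟨y.l, y.var, y.stk ++ R⟩`,
`y = Φ ⟨l, v, W⟩`. [cite: AroraBarak2009, §1.4 (universal simulation, one step)] -/
theorem passT₀_eval_preEnc
    (hΦ : ∀ x : c.tm.Cfg, (∀ k, (x.stk k).length ≤ D c) → ∀ k, ((Φ x).stk k).length ≤ 2 * D c)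
    (W R : Fin c.nK → List (Sym c)) (hW : ∀ k, (W k).length ≤ D c) :
    (passT₀ c Φ).eval (preEnc c l v W R) =
      encCfg c ⟨(Φ ⟨l, v, W⟩).l, (Φ ⟨l, v, W⟩).var, fun k => (Φ ⟨l, v, W⟩).stk k ++ R k⟩ := by
  obtain ⟨k, ks, hord⟩ := ord_eq_cons c
  set y : c.tm.Cfg := Φ ⟨l, v, W⟩ with hy
  have hWin : ofWin c (toWin c W) = W := by
    rw [ofWin_toWin]; funext j; exact List.take_of_length_le (hW j)
  have hpend : (ord c).map (fun j => (y.stk j).take (2 * D c)) = (ord c).map y.stk :=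
    List.map_congr_left fun j _ => List.take_of_length_le (hΦ ⟨l, v, W⟩ hW j)
  have hstep : (passT₀ c Φ).step (initSt c) (Blk.hdr l v (toWin c W)) =
      (⟨Phase.body, false, y.l, y.var, (ord c).map y.stk, [], []⟩, []) := by
    simp only [passT₀, rstep, initSt, if_true, hWin, ← hy, hpend]
  have hrun : (passT₀ c Φ).run (passT₀ c Φ).init (preEnc c l v W R) =
      (⟨Phase.body, true, y.l, y.var, [],
          (finOf c R ks (ks.map y.stk) [] ((y.stk k ++ R k).take (D c))).1,
          (finOf c R ks (ks.map y.stk) [] ((y.stk k ++ R k).take (D c))).2⟩,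
        outOf c R (k :: ks) (y.stk k :: ks.map y.stk)) := by
    rw [preEnc, FST.run_cons, show (passT₀ c Φ).init = initSt c from rfl, hstep]
    dsimp only
    rw [bodyOf, hord, List.map_cons, List.nil_append,
      run_bodies c Φ y.l y.var R ks (ks.map y.stk) k (y.stk k) false [] [] (List.length_map _)]
    rfl
  have hclose : RawSt.close ⟨Phase.body, true, y.l, y.var, [],
      (finOf c R ks (ks.map y.stk) [] ((y.stk k ++ R k).take (D c))).1,
      (finOf c R ks (ks.map y.stk) [] ((y.stk k ++ R k).take (D c))).2⟩ =
        (ord c).map fun j => (y.stk j ++ R j).take (D c) := by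
    rw [RawSt.close, if_pos rfl, finOf_eq, hord, List.map_cons]; rfl
  rw [FST.eval, hrun]
  simp only [passT₀, if_true]
  rw [rfront, if_pos ⟨rfl, rfl, by rw [hclose, List.length_map, length_ord]⟩, hclose,
    ← List.map_cons, ← hord, outOf_eq, encCfg_eq, bodyOf, List.singleton_append]
  congr 2
  rw [show (fun j => (List.map (fun j => List.take (D c) (y.stk j ++ R j)) (ord c)).getD
      (List.idxOf j (ord c)) []) = fun j => (y.stk j ++ R j).take (D c) from
    funext fun j => getD_map_ord c _ j]
  exact toWin_take c _

end Semantics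

/-! ### The finite transducer -/

/-- The invariant of reachable raw states: boundedly many pending segments of length `≤ 2D`,
boundedly many finalised windows of length `≤ D`, a collected window of length `≤ D`. [folklore] -/
structure Inv (s : RawSt c) : Prop where
  /-- at most `nK` pending segments -/
  pend_len : s.pend.length ≤ c.nK
  /-- pending segments are short -/
  pend_bd : ∀ W ∈ s.pend, W.length ≤ 2 * D c
  /-- at most `nK` finalised windows -/
  done_len : s.done.length + s.pend.length + (if s.cur then 1 else 0) ≤ c.nK
  /-- finalised windows are short -/
  done_bd : ∀ W ∈ s.done, W.length ≤ D c
  /-- the collected window is short -/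
  acc_bd : s.acc.length ≤ D c

/-- The initial state satisfies the invariant. [folklore] -/
theorem inv_initSt : Inv c (initSt c) :=
  ⟨by simp [initSt], by simp [initSt], by simp [initSt], by simp [initSt], by simp [initSt]⟩

/-- The dead state satisfies the invariant. [folklore] -/
theorem inv_deadSt : Inv c (deadSt c) :=
  ⟨by simp [deadSt], by simp [deadSt], by simp [deadSt], by simp [deadSt], by simp [deadSt]⟩

/-- **The invariant is preserved.** [folklore] -/
theorem inv_rstep (Φ : c.tm.Cfg → c.tm.Cfg) {s : RawSt c} (hs : Inv c s) (a : Blk c) :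
    Inv c (rstep c Φ s a).1 := by
  cases a with
  | hdr l v w =>
    simp only [rstep]
    split_ifs with h
    · refine ⟨by simp [length_ord], fun W hW => ?_, by simp [length_ord], by simp, by simp⟩
      simp only [List.mem_map] at hW
      obtain ⟨k, -, rfl⟩ := hW
      exact List.length_take_le _ _
    · exact inv_deadSt c
  | sep =>
    simp only [rstep]
    split_ifs with h
    · rcases hp : s.pend with _ | ⟨W, Ws⟩
      · exact inv_deadSt c
      · have h1 := hs.pend_len
        have h3 := hs.done_len
        rw [hp] at h1 h3
        simp only [List.length_cons] at h1 h3
        refine ⟨by simp; omega, fun W' hW' => hs.pend_bd W' (by rw [hp]; exact List.mem_cons_of_mem _ hW'),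
          ?_, fun W' hW' => ?_, List.length_take_le _ _⟩
        · simp only [RawSt.close, if_true]
          split_ifs at h3 ⊢ with hc <;> simp <;> omega
        · simp only [RawSt.close] at hW'
          split_ifs at hW' with hc
          · rw [List.mem_append, List.mem_singleton] at hW'
            rcases hW' with hW' | rfl
            · exact hs.done_bd W' hW'
            · exact hs.acc_bd
          · exact hs.done_bd W' hW'
    · exact inv_deadSt c
  | sym g =>
    simp only [rstep]
    split_ifs with h h'
    · exact ⟨hs.pend_len, hs.pend_bd, hs.done_len, hs.done_bd, by simp; omega⟩
    · exact hs
    · exact inv_deadSt c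

/-- Lists of boundedly many bounded lists over a finite alphabet form a finite set. [folklore] -/
theorem finite_setOf_boundedLists (α : Type) [Finite α] (m n : ℕ) :
    {L : List (List α) | L.length ≤ m ∧ ∀ l ∈ L, l.length ≤ n}.Finite := by
  haveI : Finite {l : List α // l.length ≤ n} := (List.finite_length_le α n).to_subtype
  refine ((List.finite_length_le {l : List α // l.length ≤ n} m).image
    (List.map Subtype.val)).subset ?_
  rintro L ⟨hL, hl⟩
  refine ⟨L.pmap (fun l h => ⟨l, h⟩) fun l h => hl l h, by simpa using hL, ?_⟩
  rw [List.map_pmap]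
  exact List.pmap_eq_self.2 fun _ _ => rfl

/-- **The states satisfying the invariant form a finite type.** [folklore] -/
abbrev St : Type := {s : RawSt c // Inv c s}

/-- Finiteness of the state type. [folklore] -/
instance : Finite (St c) := by
  haveI h1 : Finite ↥{L : List (List (Sym c)) | L.length ≤ c.nK ∧ ∀ l ∈ L, l.length ≤ 2 * D c} :=
    (finite_setOf_boundedLists (Sym c) c.nK (2 * D c)).to_subtype
  haveI h2 : Finite ↥{L : List (List (Sym c)) | L.length ≤ c.nK ∧ ∀ l ∈ L, l.length ≤ D c} :=
    (finite_setOf_boundedLists (Sym c) c.nK (D c)).to_subtype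
  haveI h3 : Finite ↥{l : List (Sym c) | l.length ≤ D c} := (List.finite_length_le (Sym c) (D c)).to_subtype
  refine Finite.of_injective (β := Phase × Bool × Option (Fin c.nΛ) × Fin c.nσ ×
      ↥{L : List (List (Sym c)) | L.length ≤ c.nK ∧ ∀ l ∈ L, l.length ≤ 2 * D c} ×
      ↥{L : List (List (Sym c)) | L.length ≤ c.nK ∧ ∀ l ∈ L, l.length ≤ D c} ×
      ↥{l : List (Sym c) | l.length ≤ D c})
    (fun s => (s.1.phase, s.1.cur, s.1.lbl, s.1.var, ⟨s.1.pend, s.2.pend_len, s.2.pend_bd⟩,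
      ⟨s.1.done, by have := s.2.done_len; exact le_trans (by omega) this, s.2.done_bd⟩,
      ⟨s.1.acc, s.2.acc_bd⟩)) ?_
  rintro ⟨s, hs⟩ ⟨t, ht⟩ h
  simp only [Prod.mk.injEq, Subtype.mk.injEq] at h
  obtain ⟨h1, h2, h3, h4, h5, h6, h7⟩ := h
  exact Subtype.ext (RawSt.ext h1 h2 h3 h4 h5 h6 h7)

/-- The (noncomputable) enumeration of the state type. [folklore] -/
instance : Fintype (St c) := Fintype.ofFinite _

/-- **The transducer** of the configuration map `Φ`: the raw transducer restricted to the states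
satisfying the invariant. [cite: AroraBarak2009, §1.4 (one step of a universal simulation)] -/
def passT (Φ : c.tm.Cfg → c.tm.Cfg) : FST (St c) (Blk c) (Blk c) where
  init := ⟨initSt c, inv_initSt c⟩
  step := fun s a => (⟨(rstep c Φ s.1 a).1, inv_rstep c Φ s.2 a⟩, (rstep c Φ s.1 a).2)
  front := fun s => rfront c s.1
  keep := fun _ => true

/-- The transducer runs like the raw transducer. [folklore] -/
theorem passT_run (Φ : c.tm.Cfg → c.tm.Cfg) :
    ∀ (w : List (Blk c)) (s : St c),
      ((passT c Φ).run s w).1.1 = ((passT₀ c Φ).run s.1 w).1 ∧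
        ((passT c Φ).run s w).2 = ((passT₀ c Φ).run s.1 w).2 := by
  intro w
  induction w with
  | nil => intro s; simp
  | cons a w ih =>
    intro s
    rw [FST.run_cons, FST.run_cons]
    obtain ⟨h1, h2⟩ := ih ((passT c Φ).step s a).1
    exact ⟨h1, by rw [h2]; rfl⟩

/-- The transducer computes what the raw transducer computes. [folklore] -/
theorem passT_eval (Φ : c.tm.Cfg → c.tm.Cfg) (w : List (Blk c)) :
    (passT c Φ).eval w = (passT₀ c Φ).eval w := by
  obtain ⟨h1, h2⟩ := passT_run c Φ w (passT c Φ).init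
  change rfront c ((passT c Φ).run (passT c Φ).init w).1.1 ++
      (if true then ((passT c Φ).run (passT c Φ).init w).2 else []) =
    rfront c ((passT₀ c Φ).run (initSt c) w).1 ++
      (if true then ((passT₀ c Φ).run (initSt c) w).2 else [])
  rw [h1, h2]
  rfl

/-- **The transducer on a pre-code** (from `passT₀_eval_preEnc`). [cite: AroraBarak2009, §1.4 (universal simulation, one step)] -/
theorem passT_eval_preEnc (Φ : c.tm.Cfg → c.tm.Cfg)
    (hΦ : ∀ x : c.tm.Cfg, (∀ k, (x.stk k).length ≤ D c) → ∀ k, ((Φ x).stk k).length ≤ 2 * D c)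
    (l : Option (Fin c.nΛ)) (v : Fin c.nσ) (W R : Fin c.nK → List (Sym c))
    (hW : ∀ k, (W k).length ≤ D c) :
    (passT c Φ).eval (preEnc c l v W R) =
      encCfg c ⟨(Φ ⟨l, v, W⟩).l, (Φ ⟨l, v, W⟩).var, fun k => (Φ ⟨l, v, W⟩).stk k ++ R k⟩ := by
  rw [passT_eval, passT₀_eval_preEnc c Φ l v hΦ W R hW]

/-! ### One machine step; normal forms -/

/-- **The step transducer**: `passT` of the total step function `stepTotal` (one step of the
machine, the identity once halted). [cite: AroraBarak2009, §1.4 and proof of Thm. 1.9] -/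
def stepT : FST (St c) (Blk c) (Blk c) := passT c (stepTotal c.tm)

/-- One total step lengthens truncated stacks to at most `2D`. [folklore] -/
theorem length_stepTotal_stk_le (x : c.tm.Cfg) (hx : ∀ k, (x.stk k).length ≤ D c) (k : Fin c.nK) :
    ((stepTotal c.tm x).stk k).length ≤ 2 * D c := by
  have h1 := length_stepTotal_le c.tm x k
  have h2 := hx k
  have h3 := depth_le_D c
  omega

/-- **The step transducer computes one machine step on codes**: `stepT.eval (encCfg x) =
encCfg (stepTotal x)` — by the window lemma, the step on the truncated configuration followed by
re-appending the parts below depth `D` is the step. [cite: Sipser2012, Thm. 9.30 (proof: each row of the tableau from the previous one)] -/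
theorem stepT_eval_encCfg (x : c.tm.Cfg) :
    (stepT c).eval (encCfg c x) = encCfg c (stepTotal c.tm x) := by
  have hpre : encCfg c x = preEnc c x.l x.var (fun k => (x.stk k).take (D c)) fun k => (x.stk k).drop (D c) := by
    rw [encCfg, preEnc, preEnc, toWin_take]
  rw [stepT, hpre, passT_eval_preEnc c _ (length_stepTotal_stk_le c) _ _ _ _
    (fun k => List.length_take_le _ _)]
  congr 1
  obtain ⟨l, v, S⟩ := x
  exact (stepTotal_window c.tm ⟨l, v, S⟩ (D c) (depth_le_D c)).symm

/-- Iterated steps on codes. [cite: AroraBarak2009, proof of Thm. 1.9] -/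
theorem iterate_stepT_eval_encCfg (x : c.tm.Cfg) (n : ℕ) :
    (stepT c).eval^[n] (encCfg c x) = encCfg c ((stepTotal c.tm)^[n] x) := by
  induction n generalizing x with
  | zero => rfl
  | succ n ih => rw [Function.iterate_succ_apply, Function.iterate_succ_apply, stepT_eval_encCfg, ih]

/-- **The normalising transducer**: `passT id` (re-split every stack of a pre-code into window
and body). [cite: AroraBarak2009, §1.4] -/
def normT : FST (St c) (Blk c) (Blk c) := passT c id

/-- **Normal form of a pre-code**: with windows `W` (`|W k| ≤ D`) and bodies `R`, the normaliser
outputs the code of the configuration `⟨l, v, W ++ R⟩`. [cite: AroraBarak2009, §1.4] -/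
theorem normT_eval_preEnc (l : Option (Fin c.nΛ)) (v : Fin c.nσ) (W R : Fin c.nK → List (Sym c))
    (hW : ∀ k, (W k).length ≤ D c) :
    (normT c).eval (preEnc c l v W R) = encCfg c ⟨l, v, fun k => W k ++ R k⟩ := by
  rw [normT, passT_eval_preEnc c id (fun x hx k => (hx k).trans (by omega)) l v W R hW]
  rfl

/-- In particular the code of the configuration with empty windows and bodies `R` normalises to
the code of `⟨l, v, R⟩` (initial configurations: `R` = the input word on the input stack).
[cite: AroraBarak2009, §1.4] -/
theorem normT_eval_preEnc_nil (l : Option (Fin c.nΛ)) (v : Fin c.nσ) (R : Fin c.nK → List (Sym c)) :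
    (normT c).eval (preEnc c l v (fun _ => []) R) = encCfg c ⟨l, v, R⟩ := by
  rw [normT_eval_preEnc c l v _ R fun _ => by simp]
  rfl

end CfgCodes

end Literature.Computability.Complexity

end
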